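import Mathlib
import HarnessLib

/-!
# Crux `NNLinearDegreeCofactorHard` (stmt-ValiantsHypothesis-23918), line `internal_cofactor`, stub S2b (ii):
# the INFLATED QUEUE WORD — definitions (unit (A″) of the SPEC `Lines/internal_cofactor-S2b-SPEC.md`)

The objects posited by the S2b(ii) measure design of record (SPEC @4867770a0ced, S1–S6; design memo v2 §5:
«R ≡ pop with pre-inflation»), on the carved window `Fin N` with defect set `R` (every defect letter is a POP):

* `decodePair` (S2) — the NEUTRAL decoder `00 ↦ DD, 01 ↦ DU, 10 ↦ UD, 11 ↦ UU` and the INFLATION decoder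
  `00 ↦ UU, 01 ↦ UD, 10 ↦ DU, 11 ↦ UU` of a pair of non-defect letters from two bits (`true` = push `U`);
* `vrank R t` / `vpos R i` — the number of non-defect positions before `t` / the position of the `i`-th non-defect
  position (the non-defect positions of V-ranks `2j, 2j+1` form PAIR `j`);
* `tailPairs R L m` (`jE`, S5: the last `#Rᶜ − 2·jE ∈ {L+3m, L+3m+1}` non-defect positions are the TAIL) and
  `tailStart` (`E′ = vpos (2·jE)`);
* `need R L m t` (S3) — the backward recursion from `E′`: `+1` across a defect, `−1` at a pair start when positive
  (that pair is then an INFLATION pair, `isInflate`), constant otherwise; the envelope of the SPEC is `L + need`;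
* `headPairs R L m` (`jA`, S4) — the least pair index at which the all-push height `2j − #(R ∩ [0, vpos 2j))` reaches
  `L + need`; head pairs push regardless of their bits;
* `preLetter`, `tailHeight`, `tailPushes` (S5: the adaptive drain — the first `k` tail non-defect letters push, the
  rest pop, `k = (T_V + #R_tail − h(E′)) / 2`), and THE WORD `inflateWord R L m y : Fin N → Bool` (S6) for bits
  `y : Fin (2 * (#Rᶜ / 2)) → Bool` (pair `j` reads bits `2j, 2j+1`; head and tail bits are unread).

Only definitions and their defining value lemmas; ranks, ballot-ness, `R`-avoidance, the strict-past lemma and the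
height/envelope identities are proved in `…InflateWordRanks.lean` and the other `FifoMatchingNNLinearDegreeCofactorHard*`
files.  Nothing here bears on VP ≠ VNP.
-/

-- Sub = Summit single-conjunct layout: the duplicated namespace component is mandated by the tree.
set_option linter.dupNamespace false

namespace Summit.ValiantsHypothesis.ValiantsHypothesis.Theorems.FifoMatching.NNLinearDegreeCofactorHard.InflateWord

open Finset

/-- **The pair decoders** (S2; `true` = push): NEUTRAL `(b₀, b₁) ↦ (b₀, b₁)`; INFLATION (`κ = true`)
`00 ↦ UU, 01 ↦ UD, 10 ↦ DU, 11 ↦ UU`. [folklore] -/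
def decodePair (κ b₀ b₁ : Bool) : Bool × Bool :=
  if κ then (!(b₀ && !b₁), !(!b₀ && b₁)) else (b₀, b₁)

variable {N : ℕ} (R : Finset (Fin N))

/-- The V-rank of `t`: the number of non-defect positions `< t`. [folklore] -/
def vrank (t : ℕ) : ℕ := (Rᶜ.filter fun i : Fin N => (i : ℕ) < t).card

/-- The position of the non-defect position of V-rank `i` (`N` if `i ≥ #Rᶜ`). [folklore] -/
noncomputable def vpos (i : ℕ) : ℕ :=
  if h : i < Rᶜ.card then ((Rᶜ.orderEmbOfFin rfl ⟨i, h⟩ : Fin N) : ℕ) else N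

/-- The number of tail pairs' complement: `jE := (#Rᶜ − (L + 3m)) / 2`; pairs `j < jE` are head or middle, the
non-defect positions of V-rank `≥ 2·jE` are the TAIL (S5). [folklore] -/
def tailPairs (L m : ℕ) : ℕ := (Rᶜ.card - (L + 3 * m)) / 2

/-- The tail start `E′`: the position of V-rank `2·jE`. [folklore] -/
noncomputable def tailStart (L m : ℕ) : ℕ := vpos R (2 * tailPairs R L m)

/-- The backward recursion of S3, `needAux E k = need (E − k)`: across a defect `need` gains `1` (to the left),
at a pair start (non-defect position of even V-rank) a positive `need` loses `1` (that pair inflates), otherwise it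
is carried. [folklore] -/
def needAux (E : ℕ) : ℕ → ℕ
  | 0 => 0
  | k + 1 =>
    if (R.filter fun i : Fin N => (i : ℕ) = E - (k + 1)).Nonempty then needAux E k + 1
    else if E - (k + 1) < N ∧ vrank R (E - (k + 1)) % 2 = 0 ∧ 0 < needAux E k then needAux E k - 1
    else needAux E k

/-- `need R L m t` (S3), recursion based at the tail start `E′` (`need = 0` from `E′` on); the SPEC's envelope is
`H t = L + need t`. [folklore] -/
noncomputable def need (L m t : ℕ) : ℕ :=
  if t < tailStart R L m then needAux R (tailStart R L m) (tailStart R L m - t) else 0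

/-- Pair `j` is an INFLATION pair iff `need` is positive just after its start (S3: `τ j`). [folklore] -/
noncomputable def isInflate (L m j : ℕ) : Bool :=
  decide (0 < need R L m (vpos R (2 * j) + 1))

/-- The number of HEAD pairs `jA` (S4): the least `j ≤ jE` at which the all-push height
`2j − #(R ∩ [0, vpos 2j))` is at least `L + need (vpos 2j)` (`jE` if there is none). [folklore] -/
noncomputable def headPairs (L m : ℕ) : ℕ :=
  if h : ((range (tailPairs R L m + 1)).filter fun j =>
      L + need R L m (vpos R (2 * j)) + (R.filter fun i : Fin N => (i : ℕ) < vpos R (2 * j)).card ≤ 2 * j).Nonempty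
  then ((range (tailPairs R L m + 1)).filter fun j =>
      L + need R L m (vpos R (2 * j)) + (R.filter fun i : Fin N => (i : ℕ) < vpos R (2 * j)).card ≤ 2 * j).min' h
  else tailPairs R L m

variable (L m : ℕ) (y : Fin (2 * (Rᶜ.card / 2)) → Bool)

/-- The letter of the non-defect position of V-rank `i` before the tail: push in the head, decoded pair letter in
the middle (junk beyond). [folklore] -/
noncomputable def preLetter (i : ℕ) : Bool :=
  if i < 2 * headPairs R L m then true
  else
    if i % 2 = 0 then
      (decodePair (isInflate R L m (i / 2))
        (if h : 2 * (i / 2) < 2 * (Rᶜ.card / 2) then y ⟨2 * (i / 2), h⟩ else false)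
        (if h : 2 * (i / 2) + 1 < 2 * (Rᶜ.card / 2) then y ⟨2 * (i / 2) + 1, h⟩ else false)).1
    else
      (decodePair (isInflate R L m (i / 2))
        (if h : 2 * (i / 2) < 2 * (Rᶜ.card / 2) then y ⟨2 * (i / 2), h⟩ else false)
        (if h : 2 * (i / 2) + 1 < 2 * (Rᶜ.card / 2) then y ⟨2 * (i / 2) + 1, h⟩ else false)).2

/-- The height `#U − #D` of the word just before the tail start `E′` (defects pop; non-defect letters by
`preLetter`). [folklore] -/
noncomputable def tailHeight : ℤ :=
  ∑ t ∈ (univ : Finset (Fin N)).filter (fun t : Fin N => (t : ℕ) < tailStart R L m),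
    (if t ∉ R ∧ preLetter R L m y (vrank R t) = true then (1 : ℤ) else -1)

/-- The number `k` of tail pushes (S5, adaptive drain): `k = (T_V + #(R ∩ [E′, N)) − h(E′)) / 2`, so that the word
ends at height `0`. [folklore] -/
noncomputable def tailPushes : ℕ :=
  (((Rᶜ.card - 2 * tailPairs R L m : ℕ) : ℤ) +
      ((R.filter fun i : Fin N => tailStart R L m ≤ (i : ℕ)).card : ℤ) - tailHeight R L m y).toNat / 2

/-- **The inflated queue word** (S6): defects pop; a non-defect position of V-rank `i` is `preLetter i` before the
tail (`i < 2·jE`) and, in the tail, pushes iff it is among the first `tailPushes` tail letters. [folklore] -/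
noncomputable def inflateWord : Fin N → Bool := fun t =>
  if t ∈ R then false
  else if vrank R t < 2 * tailPairs R L m then preLetter R L m y (vrank R t)
  else decide (vrank R t - 2 * tailPairs R L m < tailPushes R L m y)

/-! ### Defining value lemmas -/

/-- Defect positions pop (S1). [folklore] -/
theorem inflateWord_apply_of_mem {t : Fin N} (ht : t ∈ R) : inflateWord R L m y t = false := by
  unfold inflateWord; rw [if_pos ht]

/-- Non-defect positions before the tail carry `preLetter`. [folklore] -/
theorem inflateWord_apply_of_lt {t : Fin N} (ht : t ∉ R) (hi : vrank R t < 2 * tailPairs R L m) :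
    inflateWord R L m y t = preLetter R L m y (vrank R t) := by
  unfold inflateWord; rw [if_neg ht, if_pos hi]

/-- Tail non-defect positions: the first `tailPushes` push, the rest pop (S5). [folklore] -/
theorem inflateWord_apply_of_le {t : Fin N} (ht : t ∉ R) (hi : 2 * tailPairs R L m ≤ vrank R t) :
    inflateWord R L m y t = decide (vrank R t - 2 * tailPairs R L m < tailPushes R L m y) := by
  unfold inflateWord; rw [if_neg ht, if_neg (not_lt.2 hi)]

/-- Head letters push (S4). [folklore] -/
theorem preLetter_of_lt {i : ℕ} (hi : i < 2 * headPairs R L m) : preLetter R L m y i = true := by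
  unfold preLetter; rw [if_pos hi]

/-- Middle letters: V-rank `2j + e` (`e < 2`) past the head is letter `e` of the decoded pair `j` (S6). [folklore] -/
theorem preLetter_mid {j e : ℕ} (he : e < 2) (hj : 2 * headPairs R L m ≤ 2 * j + e) :
    preLetter R L m y (2 * j + e) =
      (if e = 0 then
        (decodePair (isInflate R L m j)
          (if h : 2 * j < 2 * (Rᶜ.card / 2) then y ⟨2 * j, h⟩ else false)
          (if h : 2 * j + 1 < 2 * (Rᶜ.card / 2) then y ⟨2 * j + 1, h⟩ else false)).1
       else
        (decodePair (isInflate R L m j)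
          (if h : 2 * j < 2 * (Rᶜ.card / 2) then y ⟨2 * j, h⟩ else false)
          (if h : 2 * j + 1 < 2 * (Rᶜ.card / 2) then y ⟨2 * j + 1, h⟩ else false)).2) := by
  unfold preLetter
  rw [if_neg (not_lt.2 hj)]
  have hdiv : (2 * j + e) / 2 = j := by omega
  have hmod : (2 * j + e) % 2 = e := by omega
  simp only [hdiv, hmod]

/-- `need` vanishes from the tail start on. [folklore] -/
theorem need_of_le {t : ℕ} (ht : tailStart R L m ≤ t) : need R L m t = 0 := by
  unfold need; rw [if_neg (not_lt.2 ht)]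

/-- The NEUTRAL decoder is the identity on the two bits. [folklore] -/
@[simp] theorem decodePair_false (b₀ b₁ : Bool) : decodePair false b₀ b₁ = (b₀, b₁) := rfl

/-- The INFLATION decoder. [folklore] -/
@[simp] theorem decodePair_true (b₀ b₁ : Bool) :
    decodePair true b₀ b₁ = (!(b₀ && !b₁), !(!b₀ && b₁)) := rfl

end Summit.ValiantsHypothesis.ValiantsHypothesis.Theorems.FifoMatching.NNLinearDegreeCofactorHard.InflateWord
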